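import Summits.QuantumFields.YangMills.Theses.SamplerStability

/-!
# STUB 3 `stub_conditionalBernsteinCM` — LINE 12 «bernstein_rate» v2, crux `SpecificationRate` (stmt-QuantumFields-28041, route `SamplerStability`)

Candidate file of planner ym-idea-5 g15 (HOME/stubplan-g15/BernsteinCM.lean, verified rc 0 by critic idea-crit-5 NOTE #168), landed by
width seat ym-line-sfw-p2-w3 g29 (free hands).  The skeleton's declarations (ll.33–114 of the registered skeleton, sha256 ea217006…) are
copied VERBATIM, so `__Registered.stub_conditionalBernsteinCM` is the registered Prop; then a sorry-free proof WITHOUT conditional Jensen: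
`Y = log h`, `mY = E[Y|m]`, `X = Y − mY`, `S = √h`, `c = e^{mY/2}`; (1) `E[e^X|m] ≥ 1` (`e^x ≥ 1+x`, `E[X|m] = 0`) ⇒ `e^{mY} ≤ E[h|m]`;
(2) variational bound `∫ h − ∫ E[S|m]² ≤ ∫ (S − c)²`; (3) `(S − c)² ≤ (e^{η⁺}/4)·e^{mY}·X²` on `{X ≤ η}`; (4) weight transfer
`∫⁻ e^{mY} X² ≤ ∫ h·E[X²|m]` by truncation + monotone convergence; (5) chain, constant `e^{η⁺}/4 ≤ c_B(η)`.
HONEST FRAMING: STUB 1/2 (`stub_mutualDensity`, `stub_logIncrementCondVariance`) are NOT proved; no crux, rung or mass gap is proved.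
-/

namespace Summit.QuantumFields.YangMills.Cruxes.SpecificationRate.BernsteinRate
open scoped BigOperators Topology Classical MeasureTheory ProbabilityTheory NNReal ENNReal
open Filter Set Function MeasureTheory
open Literature.MathematicalPhysics.QuantumFieldTheory
open Literature.MathematicalPhysics.QuantumFieldTheory.Balaban1983to89

/-- The gauge group `SU(2)`. -/
abbrev G2 : Type := Matrix.specialUnitaryGroup (Fin 2) ℂ

/-- Bałaban's small-loop average used by the leaf. -/
noncomputable abbrev avSU : LoopAverage G2 := ExpMeanLog.expMeanLogSU

variable (F : T3ContinuumYM3Torus.T3Family)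

/-- The fixed unit-lattice configuration space `X₀ = SU(2)^{unit bonds}`. -/
abbrev X0 : Type := GaugeField (F.P 0) 0 G2

/-- The renormalised unit law `ρ_K` at parameter `γ`. -/
noncomputable abbrev rho (γ : ℝ) (K : ℕ) : Measure (X0 F) :=
  F.unitLaw avSU T4ApexTwoLevel.measurableE_expMeanLogSU γ K

/-- The σ-algebra generated by all unit links except `e`. -/
noncomputable abbrev envSigma (e : PBond (F.P 0) 0) : MeasurableSpace (X0 F) :=
  MeasurableSpace.comap (fun (W : X0 F) (b : {b : PBond (F.P 0) 0 // b ≠ e}) => W b.1) MeasurableSpace.pi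

/-- The heat-bath Dirichlet energy of `√h`: `Σ_e (∫ h dμ − ∫ (E_μ[√h | links ≠ e])² dμ)` (the crux's left-hand side). -/
noncomputable abbrev sqrtEnergy (μ : Measure (X0 F)) (h : X0 F → ℝ) : ℝ :=
  ∑ e : PBond (F.P 0) 0, ((∫ V, h V ∂μ) - ∫ V, (condExp (envSigma F e) μ (fun W => Real.sqrt (h W)) V) ^ 2 ∂μ)

/-- The conditionally centred log-increment at link `e`: `X_e = log h − E_μ[log h | links ≠ e]`. -/
noncomputable abbrev ctr (μ : Measure (X0 F)) (e : PBond (F.P 0) 0) (h : X0 F → ℝ) : X0 F → ℝ :=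
  fun V => Real.log (h V) - condExp (envSigma F e) μ (fun W => Real.log (h W)) V

/-- The conditional second moment of the centred log-increment under the OLD law: `E_μ[X_e² | links ≠ e]`. -/
noncomputable abbrev cvar (μ : Measure (X0 F)) (e : PBond (F.P 0) 0) (h : X0 F → ℝ) : X0 F → ℝ :=
  condExp (envSigma F e) μ (fun W => (ctr F μ e h W) ^ 2)

/-- The `h`-weighted conditional-variance functional `Σ_e ∫ h · E_μ[X_e² | links ≠ e] dμ` ( = `Σ_e E_{h·μ} Var_μ(log h | links ≠ e)` ). -/
noncomputable abbrev wVar (μ : Measure (X0 F)) (h : X0 F → ℝ) : ℝ :=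
  ∑ e : PBond (F.P 0) 0, ∫ V, h V * cvar F μ e h V ∂μ

/-- The Bernstein constant `e^{max(η,0)}/2`. -/
noncomputable abbrev cB (η : ℝ) : ℝ := Real.exp (max η 0) / 2

/-! ## Stubs -/

/-- STUB 1 (L; shared with LINE 11). MUTUAL ABSOLUTE CONTINUITY OF CONSECUTIVE RENORMALISED UNIT LAWS, positive density. -/
def MutualDensity : Prop :=
  ∃ γ₁ : ℝ, 0 < γ₁ ∧ ∀ (F : T3ContinuumYM3Torus.T3Family) (γ : ℝ), 0 < γ → γ ≤ γ₁ →
    ∃ K₀ : ℕ, ∀ K : ℕ, K₀ ≤ K →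
      ∃ h : X0 F → ℝ, Measurable h ∧ (∀ V, 0 < h V) ∧
        rho F γ (K + 1) = (rho F γ K).withDensity (fun V => ENNReal.ofReal (h V))

/-- STUB 2 (XL, hardest, load-bearing). VARIANCE-LEVEL SPECIFICATION RATE: for every positive version `h` of `dρ_{K+1}/dρ_K`,
`log h` is `ρ_K`-integrable, its conditionally centred value has a ONE-SIDED ceiling `η` (uniform in `K`, not summable), and
the `h`-weighted OLD-law conditional variances are square-summable: `Σ_e ∫ h·E_{ρ_K}[X_e² | links ≠ e] dρ_K ≤ ι_K²`, `Σ ι_K < ∞`. -/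
def LogIncrementCondVariance : Prop :=
  ∃ γ₁ : ℝ, 0 < γ₁ ∧ ∀ (F : T3ContinuumYM3Torus.T3Family) (γ : ℝ), 0 < γ → γ ≤ γ₁ →
    ∃ (K₀ : ℕ) (η : ℝ) (ι : ℕ → ℝ), Summable ι ∧ ∀ K : ℕ, K₀ ≤ K →
      ∀ h : X0 F → ℝ, Measurable h → (∀ V, 0 < h V) →
        rho F γ (K + 1) = (rho F γ K).withDensity (fun V => ENNReal.ofReal (h V)) →
        Integrable (fun V => Real.log (h V)) (rho F γ K) ∧
        (∀ e : PBond (F.P 0) 0, Integrable (fun V => (ctr F (rho F γ K) e h V) ^ 2) (rho F γ K)) ∧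
        (∀ e : PBond (F.P 0) 0, Integrable (fun V => h V * cvar F (rho F γ K) e h V) (rho F γ K)) ∧
        (∀ e : PBond (F.P 0) 0, ∀ᵐ V ∂(rho F γ K), ctr F (rho F γ K) e h V ≤ η) ∧
        wVar F (rho F γ K) h ≤ ι K ^ 2

/-- STUB 3 (M, provable, USED in `_of`). CONDITIONAL-MOMENT BERNSTEIN BRIDGE: the energy term at link `e` is bounded by the
`h`-weighted OLD-law conditional second moment `E_μ[X_e² | links ≠ e]` of the centred log-increment, constant `e^{max(η,0)}/2`
(v1 with the pointwise weight `h·X_e²` is refuted: `stub_conditionalBernstein_false`, p641993). -/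
def ConditionalBernsteinCM : Prop :=
  ∀ (F : T3ContinuumYM3Torus.T3Family) (μ : Measure (X0 F)), IsProbabilityMeasure μ →
    ∀ (e : PBond (F.P 0) 0) (η : ℝ) (h : X0 F → ℝ), Measurable h → (∀ V, 0 < h V) → Integrable h μ →
      Integrable (fun V => Real.log (h V)) μ → Integrable (fun V => (ctr F μ e h V) ^ 2) μ →
      Integrable (fun V => h V * cvar F μ e h V) μ → (∀ᵐ V ∂μ, ctr F μ e h V ≤ η) →
      (∫ V, h V ∂μ) - ∫ V, (condExp (envSigma F e) μ (fun W => Real.sqrt (h W)) V) ^ 2 ∂μ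
        ≤ cB η * ∫ V, h V * cvar F μ e h V ∂μ

namespace __Registered
/-- registered stub alias -/ abbrev stub_mutualDensity : Prop := MutualDensity
/-- registered stub alias -/ abbrev stub_logIncrementCondVariance : Prop := LogIncrementCondVariance
/-- registered stub alias -/ abbrev stub_conditionalBernsteinCM : Prop := ConditionalBernsteinCM
end __Registered

/-- De-vacuity check: the environment σ-algebra IS a sub-σ-algebra (so `condExp` is the genuine one, not the junk `0`). -/
theorem envSigma_le (e : PBond (F.P 0) 0) : envSigma F e ≤ (inferInstance : MeasurableSpace (X0 F)) := by
  apply Measurable.comap_le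
  exact measurable_pi_lambda _ (fun b => measurable_pi_apply _)

/-! ## Scalar Bernstein lemma -/
section Scalar
open Real

/-- `|e^t − 1| ≤ |t| · e^{max t 0}` for all real `t`. -/
theorem abs_exp_sub_one_le (t : ℝ) : |exp t - 1| ≤ |t| * exp (max t 0) := by
  rcases le_or_gt 0 t with ht | ht
  · have h1 : 0 ≤ exp t - 1 := by linarith [add_one_le_exp t]
    have h2 : exp t - 1 ≤ t * exp t := by
      have := add_one_le_exp (-t)
      have hpos := exp_pos t
      have : (-t + 1) * exp t ≤ exp (-t) * exp t := mul_le_mul_of_nonneg_right this hpos.le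
      rw [← exp_add, neg_add_cancel, exp_zero] at this
      nlinarith
    rw [abs_of_nonneg h1, abs_of_nonneg ht, max_eq_left ht]
    exact h2
  · have h1 : exp t - 1 ≤ 0 := by
      have := exp_lt_one_iff.mpr ht
      linarith
    have h2 : 1 - exp t ≤ -t := by linarith [add_one_le_exp t]
    rw [abs_of_nonpos h1, abs_of_neg ht, max_eq_right ht.le, exp_zero, mul_one]
    linarith

/-- For `x ≤ η`: `(e^{x/2} − 1)² ≤ (e^{max η 0} / 4) · x²`. -/
theorem sq_exp_half_sub_one_le {x η : ℝ} (hx : x ≤ η) :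
    (exp (x / 2) - 1) ^ 2 ≤ exp (max η 0) / 4 * x ^ 2 := by
  have h := abs_exp_sub_one_le (x / 2)
  have hmax : exp (max (x / 2) 0) ≤ exp (max η 0 / 2) := by
    apply exp_le_exp.mpr
    rcases le_or_gt 0 x with h0 | h0
    · rw [max_eq_left (by linarith), max_eq_left (by linarith)]; linarith
    · rw [max_eq_right (by linarith)]
      have : 0 ≤ max η 0 := le_max_right _ _
      linarith
  have hnn : 0 ≤ |x / 2| := abs_nonneg _
  have h' : |exp (x / 2) - 1| ≤ |x / 2| * exp (max η 0 / 2) :=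
    h.trans (mul_le_mul_of_nonneg_left hmax hnn)
  have hsq : (exp (x / 2) - 1) ^ 2 ≤ (|x / 2| * exp (max η 0 / 2)) ^ 2 := by
    calc (exp (x / 2) - 1) ^ 2 = |exp (x / 2) - 1| ^ 2 := (sq_abs _).symm
      _ ≤ (|x / 2| * exp (max η 0 / 2)) ^ 2 :=
          pow_le_pow_left₀ (abs_nonneg _) h' 2
  calc (exp (x / 2) - 1) ^ 2 ≤ (|x / 2| * exp (max η 0 / 2)) ^ 2 := hsq
    _ = exp (max η 0) / 4 * x ^ 2 := by
        rw [mul_pow, sq_abs, ← exp_nat_mul]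
        ring_nf

end Scalar
/-! ## The generic conditional-moment Bernstein bridge (any probability space, any sub-σ-algebra) -/
section Generic
variable {Ω : Type*} {m m₀ : MeasurableSpace Ω} {μ : Measure Ω}

/-- GENERIC BRIDGE. For a positive measurable integrable `h` with `log h` integrable, centred log-increment
`X = log h − E[log h | m]` square-integrable with `h·E[X²|m]` integrable and `X ≤ η` a.e.:
`∫ h − ∫ E[√h | m]² ≤ (e^{max η 0}/2) ∫ h · E[X² | m]`. -/
theorem energy_le_weighted_condVariance (hm : m ≤ m₀) [IsProbabilityMeasure μ] (η : ℝ) (h : Ω → ℝ)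
    (hmeas : Measurable h) (hpos : ∀ ω, 0 < h ω) (hint : Integrable h μ)
    (hlog : Integrable (fun ω => Real.log (h ω)) μ)
    (hX2 : Integrable (fun ω => (Real.log (h ω) - (μ[fun ω => Real.log (h ω) | m]) ω) ^ 2) μ)
    (hhc : Integrable (fun ω => h ω *
      (μ[fun ω => (Real.log (h ω) - (μ[fun ω => Real.log (h ω) | m]) ω) ^ 2 | m]) ω) μ)
    (hceil : ∀ᵐ ω ∂μ, Real.log (h ω) - (μ[fun ω => Real.log (h ω) | m]) ω ≤ η) :
    (∫ ω, h ω ∂μ) - ∫ ω, ((μ[fun ω => Real.sqrt (h ω) | m]) ω) ^ 2 ∂μ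
      ≤ Real.exp (max η 0) / 2 * ∫ ω, h ω *
        (μ[fun ω => (Real.log (h ω) - (μ[fun ω => Real.log (h ω) | m]) ω) ^ 2 | m]) ω ∂μ := by
  -- the three conditional-expectation atoms
  set mY : Ω → ℝ := μ[fun ω => Real.log (h ω) | m] with hmYdef
  set cv : Ω → ℝ := μ[fun ω => (Real.log (h ω) - mY ω) ^ 2 | m] with hcvdef
  set P : Ω → ℝ := μ[fun ω => Real.sqrt (h ω) | m] with hPdef
  /- (A) measurability -/
  have hmY_sm : StronglyMeasurable[m] mY := stronglyMeasurable_condExp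
  have hmY_m : Measurable mY := (hmY_sm.mono hm).measurable
  have hmY_int : Integrable mY μ := integrable_condExp
  have hY_m : Measurable (fun ω => Real.log (h ω)) := hmeas.log
  have hX_m : Measurable (fun ω => Real.log (h ω) - mY ω) := hY_m.sub hmY_m
  have hS_m : Measurable (fun ω => Real.sqrt (h ω)) := hmeas.sqrt
  have hW_sm : StronglyMeasurable[m] (fun ω => Real.exp (mY ω)) :=
    Real.continuous_exp.comp_stronglyMeasurable hmY_sm
  have hc_cont : Continuous fun y : ℝ => Real.exp (y / 2) := by fun_prop
  have hc_sm : StronglyMeasurable[m] (fun ω => Real.exp (mY ω / 2)) := hc_cont.comp_stronglyMeasurable hmY_sm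
  have hcv_sm : StronglyMeasurable[m] cv := stronglyMeasurable_condExp
  have hcv_int : Integrable cv μ := integrable_condExp
  have hcv_nn : 0 ≤ᵐ[μ] cv := condExp_nonneg (Eventually.of_forall fun ω => sq_nonneg _)
  /- (B) the centred exponential: `E[e^X | m] ≥ 1`, hence `e^{mY} ≤ E[h | m]` a.e. -/
  have hX_int : Integrable (fun ω => Real.log (h ω) - mY ω) μ := hlog.sub hmY_int
  have hexpX_le : ∀ᵐ ω ∂μ, Real.exp (Real.log (h ω) - mY ω) ≤ Real.exp η :=
    hceil.mono fun ω hω => Real.exp_le_exp.mpr hω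
  have hexpX_int : Integrable (fun ω => Real.exp (Real.log (h ω) - mY ω)) μ := by
    refine Integrable.mono' (integrable_const (Real.exp η)) hX_m.exp.aestronglyMeasurable ?_
    filter_upwards [hexpX_le] with ω hω
    rwa [Real.norm_eq_abs, abs_of_pos (Real.exp_pos _)]
  have hfun : (fun ω => Real.log (h ω) - mY ω + 1) = ((fun ω => Real.log (h ω)) - mY) + fun _ => (1 : ℝ) := by
    funext ω; simp only [Pi.add_apply, Pi.sub_apply]
  have hlin_int : Integrable (fun ω => Real.log (h ω) - mY ω + 1) μ := hX_int.add (integrable_const _)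
  have hlin_eq : ∀ᵐ ω ∂μ, (μ[fun ω => Real.log (h ω) - mY ω + 1 | m]) ω = 1 := by
    have hadd := condExp_add (hlog.sub hmY_int) (integrable_const (1 : ℝ)) m
    have hsub := condExp_sub hlog hmY_int m
    have hcc : μ[mY | m] = mY := condExp_of_stronglyMeasurable hm hmY_sm hmY_int
    have hconst : μ[fun _ : Ω => (1 : ℝ) | m] = fun _ => (1 : ℝ) := condExp_const hm (1 : ℝ)
    rw [hfun]
    filter_upwards [hadd, hsub] with ω h1 h2
    rw [h1, Pi.add_apply, h2, Pi.sub_apply, hcc, hconst, ← hmYdef]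
    ring
  have hmono : μ[fun ω => Real.log (h ω) - mY ω + 1 | m] ≤ᵐ[μ]
      μ[fun ω => Real.exp (Real.log (h ω) - mY ω) | m] :=
    condExp_mono hlin_int hexpX_int (Eventually.of_forall fun ω => by
      have := Real.add_one_le_exp (Real.log (h ω) - mY ω)
      simpa using this)
  have h_one_le : ∀ᵐ ω ∂μ, (1 : ℝ) ≤ (μ[fun ω => Real.exp (Real.log (h ω) - mY ω) | m]) ω := by
    filter_upwards [hmono, hlin_eq] with ω h1 h2
    rw [← h2]; exact h1
  have hprod : ((fun ω => Real.exp (mY ω)) * fun ω => Real.exp (Real.log (h ω) - mY ω)) = h := by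
    funext ω
    simp only [Pi.mul_apply]
    rw [← Real.exp_add, show mY ω + (Real.log (h ω) - mY ω) = Real.log (h ω) by ring, Real.exp_log (hpos ω)]
  have hH_eq : μ[h | m] =ᵐ[μ] (fun ω => Real.exp (mY ω)) * μ[fun ω => Real.exp (Real.log (h ω) - mY ω) | m] := by
    have := condExp_mul_of_stronglyMeasurable_left (μ := μ) hW_sm (by rw [hprod]; exact hint) hexpX_int
    rwa [hprod] at this
  have hW_le_H : ∀ᵐ ω ∂μ, Real.exp (mY ω) ≤ (μ[h | m]) ω := by
    filter_upwards [hH_eq, h_one_le] with ω h1 h2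
    rw [h1, Pi.mul_apply]
    exact le_mul_of_one_le_right (Real.exp_pos _).le h2
  have hW_int : Integrable (fun ω => Real.exp (mY ω)) μ := by
    have hH_int : Integrable (μ[h | m]) μ := integrable_condExp
    refine Integrable.mono' hH_int (hW_sm.mono hm).aestronglyMeasurable ?_
    filter_upwards [hW_le_H] with ω hω
    rwa [Real.norm_eq_abs, abs_of_pos (Real.exp_pos _)]
  /- (C) variational bound: `∫ h − ∫ P² ≤ ∫ (√h − c)²` with `c = e^{mY/2}` -/
  have hS_sq : (fun ω => Real.sqrt (h ω) ^ 2) = h := funext fun ω => Real.sq_sqrt (hpos ω).le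
  have hS_L2 : MemLp (fun ω => Real.sqrt (h ω)) 2 μ :=
    (memLp_two_iff_integrable_sq hS_m.aestronglyMeasurable).2 (by rw [hS_sq]; exact hint)
  have hc_sq : (fun ω => Real.exp (mY ω / 2) ^ 2) = fun ω => Real.exp (mY ω) :=
    funext fun ω => by rw [sq, ← Real.exp_add, add_halves]
  have hc_L2 : MemLp (fun ω => Real.exp (mY ω / 2)) 2 μ :=
    (memLp_two_iff_integrable_sq (hc_sm.mono hm).aestronglyMeasurable).2 (by rw [hc_sq]; exact hW_int)
  have hP_L2 : MemLp P 2 μ := hS_L2.condExp one_le_two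
  have hS_int : Integrable (fun ω => Real.sqrt (h ω)) μ := hS_L2.integrable one_le_two
  have hcS_int : Integrable ((fun ω => Real.exp (mY ω / 2)) * fun ω => Real.sqrt (h ω)) μ :=
    hc_L2.integrable_mul hS_L2
  have hcP_int : Integrable ((fun ω => Real.exp (mY ω / 2)) * P) μ := hc_L2.integrable_mul hP_L2
  have hPP_int : Integrable (fun ω => P ω ^ 2) μ := hP_L2.integrable_sq
  have hcc_int : Integrable (fun ω => Real.exp (mY ω / 2) ^ 2) μ := hc_L2.integrable_sq
  have key : ∫ ω, ((fun ω => Real.exp (mY ω / 2)) * fun ω => Real.sqrt (h ω)) ω ∂μ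
      = ∫ ω, ((fun ω => Real.exp (mY ω / 2)) * P) ω ∂μ := by
    rw [← integral_condExp hm (μ := μ) (f := (fun ω => Real.exp (mY ω / 2)) * fun ω => Real.sqrt (h ω))]
    exact integral_congr_ae (condExp_mul_of_stronglyMeasurable_left hc_sm hcS_int hS_int)
  have e1 : ∫ ω, (Real.sqrt (h ω) - Real.exp (mY ω / 2)) ^ 2 ∂μ
      = (∫ ω, h ω ∂μ) + (∫ ω, Real.exp (mY ω / 2) ^ 2 ∂μ)
        - 2 * ∫ ω, ((fun ω => Real.exp (mY ω / 2)) * fun ω => Real.sqrt (h ω)) ω ∂μ := by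
    have hpt : (fun ω => (Real.sqrt (h ω) - Real.exp (mY ω / 2)) ^ 2)
        = fun ω => (h ω + Real.exp (mY ω / 2) ^ 2)
          - 2 * ((fun ω => Real.exp (mY ω / 2)) * fun ω => Real.sqrt (h ω)) ω := by
      funext ω
      simp only [Pi.mul_apply]
      rw [sub_sq, Real.sq_sqrt (hpos ω).le]; ring
    have hF1 : Integrable (fun ω => h ω + Real.exp (mY ω / 2) ^ 2) μ := hint.add hcc_int
    have hG1 : Integrable (fun ω => 2 * ((fun ω => Real.exp (mY ω / 2)) * fun ω => Real.sqrt (h ω)) ω) μ :=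
      hcS_int.const_mul 2
    rw [hpt, integral_sub hF1 hG1, integral_add hint hcc_int, integral_const_mul]
  have e2 : ∫ ω, (P ω - Real.exp (mY ω / 2)) ^ 2 ∂μ
      = (∫ ω, P ω ^ 2 ∂μ) + (∫ ω, Real.exp (mY ω / 2) ^ 2 ∂μ)
        - 2 * ∫ ω, ((fun ω => Real.exp (mY ω / 2)) * P) ω ∂μ := by
    have hpt : (fun ω => (P ω - Real.exp (mY ω / 2)) ^ 2)
        = fun ω => (P ω ^ 2 + Real.exp (mY ω / 2) ^ 2) - 2 * ((fun ω => Real.exp (mY ω / 2)) * P) ω := by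
      funext ω
      simp only [Pi.mul_apply]
      ring
    have hF2 : Integrable (fun ω => P ω ^ 2 + Real.exp (mY ω / 2) ^ 2) μ := hPP_int.add hcc_int
    have hG2 : Integrable (fun ω => 2 * ((fun ω => Real.exp (mY ω / 2)) * P) ω) μ := hcP_int.const_mul 2
    rw [hpt, integral_sub hF2 hG2, integral_add hPP_int hcc_int, integral_const_mul]
  have e3 : 0 ≤ ∫ ω, (P ω - Real.exp (mY ω / 2)) ^ 2 ∂μ := integral_nonneg fun ω => sq_nonneg _
  have stepC : (∫ ω, h ω ∂μ) - ∫ ω, P ω ^ 2 ∂μ ≤ ∫ ω, (Real.sqrt (h ω) - Real.exp (mY ω / 2)) ^ 2 ∂μ := by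
    rw [e1]; linarith [e2, e3, key]
  /- (D) pointwise Bernstein bound on `{X ≤ η}` -/
  have hptw : ∀ᵐ ω ∂μ, (Real.sqrt (h ω) - Real.exp (mY ω / 2)) ^ 2
      ≤ Real.exp (max η 0) / 4 * (Real.exp (mY ω) * (Real.log (h ω) - mY ω) ^ 2) := by
    filter_upwards [hceil] with ω hω
    have hS : Real.sqrt (h ω) = Real.exp (mY ω / 2) * Real.exp ((Real.log (h ω) - mY ω) / 2) := by
      rw [← Real.exp_add, show mY ω / 2 + (Real.log (h ω) - mY ω) / 2 = Real.log (h ω) / 2 by ring,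
        Real.sqrt_eq_iff_mul_self_eq (hpos ω).le (Real.exp_pos _).le, ← Real.exp_add, add_halves,
        Real.exp_log (hpos ω)]
    have hsq : (Real.sqrt (h ω) - Real.exp (mY ω / 2)) ^ 2
        = Real.exp (mY ω) * (Real.exp ((Real.log (h ω) - mY ω) / 2) - 1) ^ 2 := by
      rw [hS, show Real.exp (mY ω) = Real.exp (mY ω / 2) ^ 2 by rw [sq, ← Real.exp_add, add_halves]]
      ring
    rw [hsq]
    have hb := sq_exp_half_sub_one_le hω
    calc Real.exp (mY ω) * (Real.exp ((Real.log (h ω) - mY ω) / 2) - 1) ^ 2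
        ≤ Real.exp (mY ω) * (Real.exp (max η 0) / 4 * (Real.log (h ω) - mY ω) ^ 2) :=
          mul_le_mul_of_nonneg_left hb (Real.exp_pos _).le
      _ = Real.exp (max η 0) / 4 * (Real.exp (mY ω) * (Real.log (h ω) - mY ω) ^ 2) := by ring
  /- (E) weight transfer by truncation + monotone convergence, in `lintegral` form -/
  have hhc' : Integrable (cv * h) μ := hhc.congr (Eventually.of_forall fun ω => mul_comm _ _)
  have hpo : μ[cv * h | m] =ᵐ[μ] cv * μ[h | m] := condExp_mul_of_stronglyMeasurable_left hcv_sm hhc' hint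
  have hHcv_int : Integrable (cv * μ[h | m]) μ := integrable_condExp.congr hpo
  have hHcv_eq : ∫ ω, (cv * μ[h | m]) ω ∂μ = ∫ ω, h ω * cv ω ∂μ := by
    rw [← integral_congr_ae hpo, integral_condExp hm]
    exact integral_congr_ae (Eventually.of_forall fun ω => mul_comm _ _)
  have hbound : ∀ n : ℕ, ∫ ω, min (Real.exp (mY ω)) n * (Real.log (h ω) - mY ω) ^ 2 ∂μ ≤ ∫ ω, h ω * cv ω ∂μ := by
    intro n
    have hWn_sm : StronglyMeasurable[m] (fun ω => min (Real.exp (mY ω)) (n : ℝ)) :=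
      ((Real.continuous_exp.min continuous_const : Continuous fun y : ℝ => min (Real.exp y) (n : ℝ))
        ).comp_stronglyMeasurable hmY_sm
    have hWn_bdd : ∀ ω, ‖min (Real.exp (mY ω)) (n : ℝ)‖ ≤ n := fun ω => by
      rw [Real.norm_eq_abs, abs_of_nonneg (le_min (Real.exp_pos _).le n.cast_nonneg)]
      exact min_le_right _ _
    have hWnZ_int : Integrable (fun ω => min (Real.exp (mY ω)) (n : ℝ) * (Real.log (h ω) - mY ω) ^ 2) μ :=
      hX2.bdd_mul (hWn_sm.mono hm).aestronglyMeasurable (Eventually.of_forall hWn_bdd)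
    have hWncv_int : Integrable (fun ω => min (Real.exp (mY ω)) (n : ℝ) * cv ω) μ :=
      hcv_int.bdd_mul (hWn_sm.mono hm).aestronglyMeasurable (Eventually.of_forall hWn_bdd)
    have hpo_n : μ[(fun ω => min (Real.exp (mY ω)) (n : ℝ)) * fun ω => (Real.log (h ω) - mY ω) ^ 2 | m]
        =ᵐ[μ] (fun ω => min (Real.exp (mY ω)) (n : ℝ)) * cv :=
      condExp_mul_of_stronglyMeasurable_left hWn_sm hWnZ_int hX2
    calc ∫ ω, min (Real.exp (mY ω)) n * (Real.log (h ω) - mY ω) ^ 2 ∂μ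
        = ∫ ω, (μ[(fun ω => min (Real.exp (mY ω)) (n : ℝ)) * fun ω => (Real.log (h ω) - mY ω) ^ 2 | m]) ω ∂μ :=
          (integral_condExp hm).symm
      _ = ∫ ω, min (Real.exp (mY ω)) (n : ℝ) * cv ω ∂μ := integral_congr_ae hpo_n
      _ ≤ ∫ ω, (cv * μ[h | m]) ω ∂μ := by
          apply integral_mono_ae hWncv_int hHcv_int
          filter_upwards [hW_le_H, hcv_nn] with ω h1 h2
          simp only [Pi.mul_apply]
          rw [mul_comm (cv ω)]
          exact mul_le_mul_of_nonneg_right ((min_le_left _ _).trans h1) h2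
      _ = ∫ ω, h ω * cv ω ∂μ := hHcv_eq
  have hsup : ∀ ω, (⨆ n : ℕ, ENNReal.ofReal (min (Real.exp (mY ω)) n * (Real.log (h ω) - mY ω) ^ 2))
      = ENNReal.ofReal (Real.exp (mY ω) * (Real.log (h ω) - mY ω) ^ 2) := by
    intro ω
    apply le_antisymm
    · exact iSup_le fun n => ENNReal.ofReal_le_ofReal
        (mul_le_mul_of_nonneg_right (min_le_left _ _) (sq_nonneg _))
    · obtain ⟨n, hn⟩ := exists_nat_ge (Real.exp (mY ω))
      exact le_iSup_of_le n (by rw [min_eq_left hn])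
  have hmono_n : ∀ ω, Monotone fun n : ℕ =>
      ENNReal.ofReal (min (Real.exp (mY ω)) n * (Real.log (h ω) - mY ω) ^ 2) := by
    intro ω a b hab
    exact ENNReal.ofReal_le_ofReal
      (mul_le_mul_of_nonneg_right (min_le_min_left _ (Nat.cast_le.mpr hab)) (sq_nonneg _))
  have hInn : 0 ≤ ∫ ω, h ω * cv ω ∂μ := by
    apply integral_nonneg_of_ae
    filter_upwards [hcv_nn] with ω hω
    exact mul_nonneg (hpos ω).le hω
  have stepT : ∫⁻ ω, ENNReal.ofReal (Real.exp (mY ω) * (Real.log (h ω) - mY ω) ^ 2) ∂μ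
      ≤ ENNReal.ofReal (∫ ω, h ω * cv ω ∂μ) := by
    have hmeas_n : ∀ n : ℕ, AEMeasurable
        (fun ω => ENNReal.ofReal (min (Real.exp (mY ω)) n * (Real.log (h ω) - mY ω) ^ 2)) μ := fun n =>
      (((hmY_m.exp.min measurable_const).mul (hX_m.pow_const 2)).ennreal_ofReal).aemeasurable
    calc ∫⁻ ω, ENNReal.ofReal (Real.exp (mY ω) * (Real.log (h ω) - mY ω) ^ 2) ∂μ
        = ∫⁻ ω, ⨆ n : ℕ, ENNReal.ofReal (min (Real.exp (mY ω)) n * (Real.log (h ω) - mY ω) ^ 2) ∂μ :=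
          lintegral_congr fun ω => (hsup ω).symm
      _ = ⨆ n : ℕ, ∫⁻ ω, ENNReal.ofReal (min (Real.exp (mY ω)) n * (Real.log (h ω) - mY ω) ^ 2) ∂μ :=
          lintegral_iSup' hmeas_n (Eventually.of_forall hmono_n)
      _ ≤ ENNReal.ofReal (∫ ω, h ω * cv ω ∂μ) := by
          refine iSup_le fun n => ?_
          have hnn : 0 ≤ᵐ[μ] fun ω => min (Real.exp (mY ω)) (n : ℝ) * (Real.log (h ω) - mY ω) ^ 2 :=
            Eventually.of_forall fun ω => mul_nonneg (le_min (Real.exp_pos _).le n.cast_nonneg) (sq_nonneg _)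
          rw [← ofReal_integral_eq_lintegral_ofReal
            (hX2.bdd_mul ((((Real.continuous_exp.min continuous_const :
                Continuous fun y : ℝ => min (Real.exp y) (n : ℝ)).comp_stronglyMeasurable hmY_sm :
                  StronglyMeasurable[m] fun ω => min (Real.exp (mY ω)) (n : ℝ)).mono hm).aestronglyMeasurable)
              (Eventually.of_forall fun ω => by
                rw [Real.norm_eq_abs, abs_of_nonneg (le_min (Real.exp_pos _).le n.cast_nonneg)]
                exact min_le_right _ _)) hnn]
          exact ENNReal.ofReal_le_ofReal (hbound n)
  /- (F) chain -/
  have hSc_int : Integrable (fun ω => (Real.sqrt (h ω) - Real.exp (mY ω / 2)) ^ 2) μ := (hS_L2.sub hc_L2).integrable_sq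
  have hC0 : 0 ≤ Real.exp (max η 0) / 4 := by positivity
  have stepE : ∫ ω, (Real.sqrt (h ω) - Real.exp (mY ω / 2)) ^ 2 ∂μ
      ≤ Real.exp (max η 0) / 4 * ∫ ω, h ω * cv ω ∂μ := by
    have hchain : ENNReal.ofReal (∫ ω, (Real.sqrt (h ω) - Real.exp (mY ω / 2)) ^ 2 ∂μ)
        ≤ ENNReal.ofReal (Real.exp (max η 0) / 4 * ∫ ω, h ω * cv ω ∂μ) := by
      rw [ofReal_integral_eq_lintegral_ofReal hSc_int (Eventually.of_forall fun ω => sq_nonneg _)]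
      calc ∫⁻ ω, ENNReal.ofReal ((Real.sqrt (h ω) - Real.exp (mY ω / 2)) ^ 2) ∂μ
          ≤ ∫⁻ ω, ENNReal.ofReal (Real.exp (max η 0) / 4
              * (Real.exp (mY ω) * (Real.log (h ω) - mY ω) ^ 2)) ∂μ :=
            lintegral_mono_ae (hptw.mono fun ω hω => ENNReal.ofReal_le_ofReal hω)
        _ = ENNReal.ofReal (Real.exp (max η 0) / 4)
              * ∫⁻ ω, ENNReal.ofReal (Real.exp (mY ω) * (Real.log (h ω) - mY ω) ^ 2) ∂μ := by
            rw [← lintegral_const_mul' _ _ ENNReal.ofReal_ne_top]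
            exact lintegral_congr fun ω => ENNReal.ofReal_mul hC0
        _ ≤ ENNReal.ofReal (Real.exp (max η 0) / 4) * ENNReal.ofReal (∫ ω, h ω * cv ω ∂μ) := by
            gcongr
        _ = ENNReal.ofReal (Real.exp (max η 0) / 4 * ∫ ω, h ω * cv ω ∂μ) := (ENNReal.ofReal_mul hC0).symm
    exact (ENNReal.ofReal_le_ofReal_iff (mul_nonneg hC0 hInn)).1 hchain
  calc (∫ ω, h ω ∂μ) - ∫ ω, P ω ^ 2 ∂μ
      ≤ ∫ ω, (Real.sqrt (h ω) - Real.exp (mY ω / 2)) ^ 2 ∂μ := stepC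
    _ ≤ Real.exp (max η 0) / 4 * ∫ ω, h ω * cv ω ∂μ := stepE
    _ ≤ Real.exp (max η 0) / 2 * ∫ ω, h ω * cv ω ∂μ :=
        mul_le_mul_of_nonneg_right (by linarith [Real.exp_pos (max η 0)]) hInn

end Generic
/-! ## The registered stub -/
/-- STUB 3 of LINE 12 v2 (registered alias, statement verbatim): the conditional-moment Bernstein bridge. -/
theorem stub_conditionalBernsteinCM : __Registered.stub_conditionalBernsteinCM := by
  intro F μ hμ e η h hmeas hpos hint hlog hX2 hhc hceil
  exact energy_le_weighted_condVariance (envSigma_le F e) η h hmeas hpos hint hlog hX2 hhc hceil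

end Summit.QuantumFields.YangMills.Cruxes.SpecificationRate.BernsteinRate
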